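import Summits.CriticalPhenomena.SAWScalingLimit.Theses.SAWRenewalTightness
import Summits.CriticalPhenomena.SAWScalingLimit.Theorems.SAWRenewalTightnessTightOfShellCrossing
import Summits.CriticalPhenomena.SAWScalingLimit.Theorems.SAWRenewalTightnessShellCrossingBoundSplit
import HarnessLib

/-!
# `EventualTightOfSubs`: the glue of the split `EventualTight ⇐ {ConfinementPositivity, BulkShellTight}`

Route `SAWRenewalTightness`, glue item `stmt-CriticalPhenomena-17589`
(`Summit.CriticalPhenomena.SAWScalingLimit.Theses.SAWRenewalTightness.EventualTightOfSubs`,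
literally `ConfinementPositivity → BulkShellTight → EventualTight`), the registered stub
`EventualTight_of_subs` of the crux `EventualTight` (`stmt-CriticalPhenomena-1372`), and the
route-repair glue `ShellCrossingBoundOfSubs` (`stmt-CriticalPhenomena-17749`,
`ConfinementPositivity → BulkShellTight → ShellCrossingBound`).

Everything here is a composition of two LANDED theorems of this directory:

* `Theorems.ShellCrossingBound_of_subs` (`…ShellCrossingBoundSplit.lean`, p138355):
  restriction positivity for nested Dobrushin domains with common marked-point sockets
  (`ConfinementPositivity`) plus per-shell tightness of the traversal count on interior shells
  (`BulkShellTight`) give the Aizenman–Burchard shell-crossing bound `ShellCrossingBound`;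
* `Theorems.TightOfShellCrossing_proof` (`…TightOfShellCrossing.lean`, item stmt-4732):
  `ShellCrossingBound → EventualTight` by the proved Aizenman–Burchard tightness criterion
  `Literature.Probability.RandomPlanarGeometry.isTightMeasureSet_of_traversalBounds`.

The hypotheses of `ShellCrossingBound_of_subs` are the bodies of the route defs
`ConfinementPositivity` and `BulkShellTight` verbatim, so the compositions type-check by
unfolding.  Nothing else is in this file.
-/

namespace Summit.CriticalPhenomena.SAWScalingLimit.Theorems

open Literature.Probability.RandomPlanarGeometry Literature.Probability.LatticeModels
open Summit.CriticalPhenomena.SAWScalingLimit.Theses.SAWRenewalTightness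

/-- **Route-repair glue `ShellCrossingBoundOfSubs` (stmt-CriticalPhenomena-17749) of route
`SAWRenewalTightness`:** `ConfinementPositivity → BulkShellTight → ShellCrossingBound` — verbatim the
landed theorem `ShellCrossingBound_of_subs` (p138355) after unfolding the two children of the split of
`EventualTight`, whose bodies are its two hypotheses.
[cite: AizenmanBurchardDuke1999, §1.b and Lemma 3.1] -/
theorem ShellCrossingBoundOfSubs_proof :
    Summit.CriticalPhenomena.SAWScalingLimit.Theses.SAWRenewalTightness.ShellCrossingBoundOfSubs := by
  unfold ShellCrossingBoundOfSubs ConfinementPositivity BulkShellTight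
  exact ShellCrossingBound_of_subs

/-- **The registered stub `EventualTight_of_subs` of the crux `EventualTight`
(stmt-CriticalPhenomena-1372), verbatim:** restriction positivity for nested Dobrushin domains with
common marked-point sockets, plus per-shell tightness of the traversal count on interior shells
(`B̄(y, 2R) ⊆ Ω`; no fixed threshold, no rate), imply eventual tightness of the pushed-forward critical
`ℤ²` SAW laws in every Dobrushin domain with an endpoint approximation.  Proof:
`TightOfShellCrossing_proof ∘ ShellCrossingBound_of_subs`.
[cite: AizenmanBurchardDuke1999, Thms 1.1-1.2 and Lemma 3.1] -/
theorem EventualTight_of_subs :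
    (∀ (D D' : DobrushinDomain) (a b : ℝ → Site 2) (d : ℝ), 0 < d →
      D'.carrier ⊆ D.carrier → D'.pt 0 = D.pt 0 → D'.pt 1 = D.pt 1 →
      D.carrier ∩ (Metric.ball (D.pt 0) d ∪ Metric.ball (D.pt 1) d) ⊆ D'.carrier →
      SAW.IsEndpointApprox D' a b →
        ∃ c δ₀ : ℝ, 0 < c ∧ 0 < δ₀ ∧ ∀ δ ∈ Set.Ioc (0 : ℝ) δ₀,
          ENNReal.ofReal c ≤ SAW.law D.carrier δ (a δ) (b δ)
            {γ | ∃ γ' : SAW.DomainSAW D'.carrier δ (a δ) (b δ),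
              γ'.walk.support = γ.walk.support}) →
    (∀ (D : DobrushinDomain) (a b : ℝ → Site 2), SAW.IsEndpointApprox D a b →
      ∀ (y : ℂ) (η R : ℝ), 0 < η → η < R → Metric.closedBall y (2 * R) ⊆ D.carrier →
        ∀ ε : ℝ, 0 < ε → ∃ (j : ℕ) (δ₁ : ℝ), 0 < δ₁ ∧ ∀ δ ∈ Set.Ioc (0 : ℝ) δ₁,
          SAW.law D.carrier δ (a δ) (b δ)
            {γ | (⟨γ.walk.toCurve (meshPoint δ)⟩ : Curve ℂ).HasTraversals j y η R} ≤
            ENNReal.ofReal ε) →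
    Summit.CriticalPhenomena.SAWScalingLimit.Theses.SAWRenewalTightness.EventualTight :=
  fun hE hB => TightOfShellCrossing_proof (ShellCrossingBound_of_subs hE hB)

/-- **Glue item `EventualTightOfSubs` (stmt-CriticalPhenomena-17589) of route `SAWRenewalTightness`:**
`ConfinementPositivity → BulkShellTight → EventualTight` — the two children of the split of the crux
`EventualTight` imply it: `TightOfShellCrossing_proof` (item stmt-4732, `ShellCrossingBound →
EventualTight`) composed with `ShellCrossingBoundOfSubs_proof` (= `ShellCrossingBound_of_subs`,
p138355); equivalently `EventualTight_of_subs` after unfolding the route definitions.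
[cite: AizenmanBurchardDuke1999, Thms 1.1-1.2 and Lemma 3.1] -/
theorem EventualTightOfSubs_proof :
    Summit.CriticalPhenomena.SAWScalingLimit.Theses.SAWRenewalTightness.EventualTightOfSubs := by
  unfold EventualTightOfSubs
  exact fun hC hB => TightOfShellCrossing_proof (ShellCrossingBoundOfSubs_proof hC hB)

end Summit.CriticalPhenomena.SAWScalingLimit.Theorems
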